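import Summits.BirchSwinnertonDyer.BirchSwinnertonDyer.Theorems.ErratumRoadFiveSelfDualCharactersSymbol
import Summits.BirchSwinnertonDyer.BirchSwinnertonDyer.Theorems.ErratumRoadFiveSelfDualLocalDefectOfFiniteFixed
import HarnessLib

/-!
# (FIX)† ⇐ [Wiles 1988 Thm 2.2]: the stub `stub_finiteFixedPartAnomalous_selfDual` of line `erratum_chain`† (crux 23253
# `ErratumThm23SigmaLeSelfDual`), GRANTED the named fact `Hida2000_thm326_ordinary_unitRoot`; hence S2♭♭† ⇐ the same
# (helper, `--supports stmt-BirchSwinnertonDyer-23253`)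

Cell `bsd-stepL`, seat `bsd-stepL-imc-p1` (prover g25, 2026-08-28). Theorems only (no definition, no named fact, no `sorry`, no instance,
no notation). THE FINAL ASSEMBLY of seat NOTES §FIX† — the twisted companion of imc-p1 g23's `FixFinal.finiteFixedPartAnomalous_of_thm326`
(p653698, crux 25505): instantiate `FixTwist.apply_ne_one_of_pow_eq_one_of_ker` (two-coordinate exponent separation) for the two diagonal
characters `χ† = ψT₀₀`, `δ† = ψT₁₁` of the SELF-DUAL module `A_g^† = Cofree Δ.selfDualRep` in the ordinary frame of `Δ.ρ` on `Γ_{K_𝔭̄}`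
(`FrameSelfDual.exists_localOrdinaryFrame_of_thm326`; torsion on `P`: `CharTorsionSelfDual.pow_eq_one_of_mem_ker`; the anticyclotomic
local symbol: `CharSymbolSelfDual.exists_symbol`), conclude `χ†(σ₁) ≠ 1 ≠ δ†(σ₁)` for every `σ₁ ∈ ker κ| ∖ ker κ'|`, and finish with the
triangular model (`exists_cofree_coordinates_triangular` at `Δ.selfDualRep`, `FrameSelfDual.conj_selfDualRep_val`,
`FixTwist.finite_fixed_of_apply_sub_one_ne_zero`): already `{a | σ₁ a = a}` is finite.

* `finiteFixedPartAnomalous_selfDual_of_thm326` — `Hida2000_thm326_ordinary_unitRoot → (FIX)†` (the v2† stub statement verbatim after `→`);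
* `stub_localDefectFiniteAnomalous_selfDual_of_thm326` — `Hida2000_thm326_ordinary_unitRoot → S2♭♭†`, by
  `LocalDefectAtSelfDual.stub_localDefectFiniteAnomalous_selfDual_of_finiteFixed` (p665828).

So, with `ErratumChainSelfDual.erratumThm23SigmaLeSelfDual_of_twoVarCore_of_localDefect` (p665011):
`ErratumThm23SigmaLeSelfDual ⟸ S1† (the OPEN two-variable core [FW21 Thm 4.41] at the twist) + Hida2000_thm326_ordinary_unitRoot`
— the whole S2 side of the re-keyed crux is kernel-checked modulo one PRINTED theorem, exactly as for 25505; v1†'s «honest residue» is gone.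

HONEST FRAMING: CONDITIONAL on the printed theorem [Wiles 1988 Thm 2.2 ∕ Hida 2000 Thm 3.26 (2)] = the tree's unproved named fact
`Hida2000_thm326_ordinary_unitRoot`; nothing about BSD for any pair; the crux stays OPEN∕PRE through S1†; closes: none (T7).

## References
* [JetchevSkinnerWan2017] §3.3 Case 3(b), §3.4 L.3.4.1; [Wiles1988] Thm 2.2; [Hida2000] Thm 3.26; [Castella2018Erratum] §2, Lemma 2.1;
  [CasselsFrohlichANT1967] VI §3.1 Thm 2, VII §6; [Greenberg1989] §1; [SerreLocalFields1979] IV §3–4; [DiamondShurman2005] Thm 5.5.3.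
-/

noncomputable section

-- D-0017: single-problem summit, the namespace repeats the problem name by design.
set_option linter.dupNamespace false
set_option autoImplicit false

open scoped MatrixGroups Matrix ModularForm NumberField
open Filter Topology Field NumberField IsDedekindDomain CongruenceSubgroup UpperHalfPlane
open Literature.NumberTheory.GaloisRepresentations Literature.NumberTheory.GaloisRepresentations.IsNonarchimedeanLocalField
open Literature.NumberTheory.EllipticCurves Literature.NumberTheory.EllipticCurves.ModularForms
open Literature.NumberTheory.EllipticCurves.GreenbergSelmer Literature.NumberTheory.EllipticCurves.BigGaloisRep
open Literature.NumberTheory.EllipticCurves.ZpExtension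

namespace Summit.BirchSwinnertonDyer.BirchSwinnertonDyer.Theorems.ErratumThm23TwoVariable.FixFinalSelfDual

set_option maxHeartbeats 6000000 in
set_option synthInstance.maxHeartbeats 200000 in
-- the `rfl` identifying `Δ.selfDualCofreeRepOver K (loc τ) a` with the cofree action is expensive (as in p653698)
/-- **(FIX)† granted [Wiles 1988 Thm 2.2]**: for the self-dual module `A_g^†` of an ordinary newform datum, `K` imaginary quadratic,
`p > 3` split, `𝔭̄ ∣ p`, `κ` anticyclotomic, `κ'` cyclotomic, and ANY `σ₁ ∈ ker κ ∖ ker κ'` (no anomalous or corner hypothesis), only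
finitely many `a ∈ A_g^†` are fixed by `P = ker κ| ∩ ker κ'|` and `σ₁` — in fact by `σ₁` alone. The v2† stub
`stub_finiteFixedPartAnomalous_selfDual` verbatim, behind the named fact `Hida2000_thm326_ordinary_unitRoot`.
[cite: JetchevSkinnerWan2017, §3.3 Case 3(b) and §3.4 Lemma 3.4.1 (arXiv:1512.06894 pp. 13–14)] [cite: Wiles1988, Thm. 2.2]
[cite: Castella2018Erratum, §2 (p. 2: the self-dual Tate twist), Lemma 2.1] [cite: Greenberg1989, §1 p. 98] -/
theorem finiteFixedPartAnomalous_selfDual_of_thm326 (hW : Hida2000_thm326_ordinary_unitRoot) :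
    ∀ {p : ℕ} [Fact p.Prime] {M : ℕ} [NeZero M] {k : ℤ}
      (g : CuspForm (CongruenceSubgroup.Gamma0 M) k) (ιg : coeffField g →+* PadicAlgCl p)
      (Δ : OrdinaryNewformDatum g p ιg)
      (K : Type) [Field K] [NumberField K] (𝔭bar : HeightOneSpectrum (𝓞 K)) (κ κ' : ZpExtension K p),
      IsNewform0 g → 2 ≤ k → Even k → ¬ p ∣ M → 3 < p →
      ‖ιg ⟨(UpperHalfPlane.qExpansion 1 ⇑g).coeff p, coeff_mem_coeffField g p⟩‖ = 1 →
      IsImaginaryQuadratic K → ((Ideal.span {(p : ℤ)}).primesOver (𝓞 K)).ncard = 2 →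
      ((p : ℕ) : 𝓞 K) ∈ 𝔭bar.asIdeal → κ.IsAnticyclotomic → κ'.IsCyclotomic →
      ∀ σ₁ : LocalGroup K (Sum.inl 𝔭bar), κ (localMap K (Sum.inl 𝔭bar) σ₁) = 1 →
        κ' (localMap K (Sum.inl 𝔭bar) σ₁) ≠ 1 →
        {a : Cofree Δ.selfDualRep (padicCoeffField ιg) |
          (∀ σ : LocalGroup K (Sum.inl 𝔭bar), κ' (localMap K (Sum.inl 𝔭bar) σ) = 1 →
            κ (localMap K (Sum.inl 𝔭bar) σ) = 1 →
            (Δ.selfDualCofreeRepOver K) (localMap K (Sum.inl 𝔭bar) σ) a = a) ∧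
          (Δ.selfDualCofreeRepOver K) (localMap K (Sum.inl 𝔭bar) σ₁) a = a}.Finite := by
  intro p _ M _ k g ιg Δ K _ _ 𝔭bar κ κ' h1 h2 h3 h4 h5 h6 h7 h8 h9 h10 h11 σ₁ h12 h13
  classical
  have hp : p.Prime := Fact.out
  have hK2 : Module.finrank ℚ K = 2 := h7.1
  haveI : FiniteDimensional ℚ (coeffField g) := IsNewform0.finiteDimensional_coeffField_holds h1
  haveI : FiniteDimensional ℚ_[p] (padicCoeffField ιg) := GreenbergSelmer.finiteDimensional_padicCoeffField ιg
  set ιO := padicCoeffIntegers.toPadicAlgCl ιg with hιO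
  have hιO_inj : Function.Injective ιO := fun x y hxy ↦ Subtype.ext (Subtype.ext hxy)
  /- (1) the frame, its torsion on `P`, and the local symbol -/
  obtain ⟨Q', hQ'⟩ := FrameSelfDual.exists_localOrdinaryFrame_of_thm326 hW Δ K 𝔭bar h1 h2 h4 h6 hK2 h8 h9
  obtain ⟨N, hN, hP⟩ := CharTorsionSelfDual.pow_eq_one_of_mem_ker Δ K 𝔭bar κ κ' h1 h2 h5 h7 h8 h9 h10 h11 Q'
    (fun τ ↦ ⟨(hQ' τ).1, (hQ' τ).2.1⟩)
  obtain ⟨σK, hK₂, hK₁, hsepχ, hsepδ⟩ :=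
    CharSymbolSelfDual.exists_symbol Δ K 𝔭bar κ κ' h1 h2 h3 h4 h5 h7 h8 h9 h10 h11 Q' hQ'
  /- (2) notation: `res`, `T`, `ψ`, the twisted entries -/
  set res : absoluteGaloisGroup (𝔭bar.adicCompletion K) → absoluteGaloisGroup ℚ :=
    fun τ ↦ absGaloisRestrict ℚ K (absGaloisRestrict K (𝔭bar.adicCompletion K) τ) with hres
  obtain ⟨T, hTfun⟩ : ∃ T, T = fun τ : absoluteGaloisGroup (𝔭bar.adicCompletion K) ↦ Q'⁻¹ * Δ.ρ (res τ) * Q' := ⟨_, rfl⟩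
  have hT : ∀ τ, T τ = Q'⁻¹ * Δ.ρ (res τ) * Q' := fun τ ↦ by rw [hTfun]
  have hT10 : ∀ τ, (T τ).val 1 0 = 0 := fun τ ↦ by rw [hT]; exact (hQ' τ).1
  have hTmul : ∀ σ τ, T (σ * τ) = T σ * T τ := fun σ τ ↦ by
    simp only [hT, hres, map_mul]; group
  have hTone : T 1 = 1 := by simp only [hT, hres, map_one, mul_one, inv_mul_cancel]
  let ψv : absoluteGaloisGroup (𝔭bar.adicCompletion K) → padicCoeffIntegers ιg :=
    fun τ ↦ ((selfDualTwistChar ιg (res τ) : (padicCoeffIntegers ιg)ˣ) : padicCoeffIntegers ιg)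
  have hψmul : ∀ σ τ, ψv (σ * τ) = ψv σ * ψv τ := by
    intro σ τ
    change ((selfDualTwistChar ιg (res (σ * τ)) : (padicCoeffIntegers ιg)ˣ) : padicCoeffIntegers ιg) = _
    simp only [hres, map_mul, Units.val_mul]
    rfl
  have hψone : ψv 1 = 1 := by
    change ((selfDualTwistChar ιg (res 1) : (padicCoeffIntegers ιg)ˣ) : padicCoeffIntegers ιg) = 1
    simp only [hres, map_one, Units.val_one]
  have hψc : Continuous ψv := by
    change Continuous fun τ ↦ ((selfDualTwistChar ιg (res τ) : (padicCoeffIntegers ιg)ˣ) : padicCoeffIntegers ιg)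
    exact Units.continuous_val.comp ((map_continuous (selfDualTwistChar ιg)).comp
      ((map_continuous (absGaloisRestrict ℚ K)).comp (map_continuous (absGaloisRestrict K (𝔭bar.adicCompletion K)))))
  let χd : absoluteGaloisGroup (𝔭bar.adicCompletion K) → padicCoeffIntegers ιg := fun τ ↦ ψv τ * (T τ).val 0 0
  let ed : absoluteGaloisGroup (𝔭bar.adicCompletion K) → padicCoeffIntegers ιg := fun τ ↦ ψv τ * (T τ).val 0 1
  let δd : absoluteGaloisGroup (𝔭bar.adicCompletion K) → padicCoeffIntegers ιg := fun τ ↦ ψv τ * (T τ).val 1 1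
  have hTc : Continuous fun τ : absoluteGaloisGroup (𝔭bar.adicCompletion K) ↦ (T τ).val := by
    rw [hTfun]
    exact Units.continuous_val.comp
      ((continuous_const.mul ((map_continuous Δ.ρ).comp ((map_continuous (absGaloisRestrict ℚ K)).comp
        (map_continuous (absGaloisRestrict K (𝔭bar.adicCompletion K)))))).mul continuous_const)
  have h00mul : ∀ σ τ, (T (σ * τ)).val 0 0 = (T σ).val 0 0 * (T τ).val 0 0 := by
    intro σ τ
    rw [hTmul, Units.val_mul, Matrix.mul_apply, Fin.sum_univ_two, hT10 τ, mul_zero, add_zero]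
  have h11mul : ∀ σ τ, (T (σ * τ)).val 1 1 = (T σ).val 1 1 * (T τ).val 1 1 := by
    intro σ τ
    rw [hTmul, Units.val_mul, Matrix.mul_apply, Fin.sum_univ_two, hT10 σ, zero_mul, zero_add]
  /- (3) the two diagonal characters as continuous monoid homomorphisms into `ℚ̄_p` -/
  let Θχ : absoluteGaloisGroup (𝔭bar.adicCompletion K) →* PadicAlgCl p :=
    { toFun := fun τ ↦ ιO (χd τ)
      map_one' := by
        change ιO (ψv 1 * (T 1).val 0 0) = 1
        rw [hψone, hTone, one_mul]; exact map_one ιO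
      map_mul' := fun σ τ ↦ by
        change ιO (ψv (σ * τ) * (T (σ * τ)).val 0 0) = ιO (ψv σ * (T σ).val 0 0) * ιO (ψv τ * (T τ).val 0 0)
        rw [hψmul, h00mul, ← map_mul]; congr 1; ring }
  let Θδ : absoluteGaloisGroup (𝔭bar.adicCompletion K) →* PadicAlgCl p :=
    { toFun := fun τ ↦ ιO (δd τ)
      map_one' := by
        change ιO (ψv 1 * (T 1).val 1 1) = 1
        rw [hψone, hTone, one_mul]; exact map_one ιO
      map_mul' := fun σ τ ↦ by
        change ιO (ψv (σ * τ) * (T (σ * τ)).val 1 1) = ιO (ψv σ * (T σ).val 1 1) * ιO (ψv τ * (T τ).val 1 1)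
        rw [hψmul, h11mul, ← map_mul]; congr 1; ring }
  have hΘχc : Continuous Θχ := by
    change Continuous fun τ ↦ ιO (ψv τ * (T τ).val 0 0)
    exact continuous_toPadicAlgCl.comp (hψc.mul (hTc.matrix_elem 0 0))
  have hΘδc : Continuous Θδ := by
    change Continuous fun τ ↦ ιO (ψv τ * (T τ).val 1 1)
    exact continuous_toPadicAlgCl.comp (hψc.mul (hTc.matrix_elem 1 1))
  let κ₁ : absoluteGaloisGroup (𝔭bar.adicCompletion K) →ₜ* Multiplicative ℤ_[p] :=
    κ'.toContinuousMonoidHom.comp (localMap K (Sum.inl 𝔭bar))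
  let κ₂ : absoluteGaloisGroup (𝔭bar.adicCompletion K) →ₜ* Multiplicative ℤ_[p] :=
    κ.toContinuousMonoidHom.comp (localMap K (Sum.inl 𝔭bar))
  have hPχ : ∀ σ, κ₁ σ = 1 → κ₂ σ = 1 → Θχ σ ^ N = 1 := by
    intro σ hσ1 hσ2
    change ιO (ψv σ * (T σ).val 0 0) ^ N = 1
    rw [hT]; exact (hP σ hσ1 hσ2).1
  have hPδ : ∀ σ, κ₁ σ = 1 → κ₂ σ = 1 → Θδ σ ^ N = 1 := by
    intro σ hσ1 hσ2
    change ιO (ψv σ * (T σ).val 1 1) ^ N = 1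
    rw [hT]; exact (hP σ hσ1 hσ2).2
  have hsepχ' : ∀ a : ℕ → ℕ, Tendsto (fun n ↦ (Θχ σK)⁻¹ ^ (a n)) atTop (𝓝 1) →
      Tendsto (fun n ↦ ((a n : ℕ) : ℤ_[p])) atTop (𝓝 0) := by
    intro a ha
    refine hsepχ a ?_
    have e : Θχ σK = ιO (ψv σK * (Q'⁻¹ * Δ.ρ (res σK) * Q').val 0 0) := by
      change ιO (ψv σK * (T σK).val 0 0) = _; rw [hT]
    rw [e] at ha; exact ha
  have hsepδ' : ∀ a : ℕ → ℕ, Tendsto (fun n ↦ (Θδ σK)⁻¹ ^ (a n)) atTop (𝓝 1) →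
      Tendsto (fun n ↦ ((a n : ℕ) : ℤ_[p])) atTop (𝓝 0) := by
    intro a ha
    refine hsepδ a ?_
    have e : Θδ σK = ιO (ψv σK * (Q'⁻¹ * Δ.ρ (res σK) * Q').val 1 1) := by
      change ιO (ψv σK * (T σK).val 1 1) = _; rw [hT]
    rw [e] at ha; exact ha
  /- (4) `χ†(σ₁) ≠ 1 ≠ δ†(σ₁)` -/
  have h12' : κ₂ σ₁ = 1 := h12
  have h13' : κ₁ σ₁ ≠ 1 := h13
  have hK₂' : κ₂ σK = 1 := hK₂
  have hK₁' : κ₁ σK ≠ 1 := hK₁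
  have hχne : Θχ σ₁ ≠ 1 :=
    FixTwist.apply_ne_one_of_pow_eq_one_of_ker Θχ hΘχc κ₁ κ₂ hN hPχ hK₂' hK₁' hsepχ' h12' h13'
  have hδne : Θδ σ₁ ≠ 1 :=
    FixTwist.apply_ne_one_of_pow_eq_one_of_ker Θδ hΘδc κ₁ κ₂ hN hPδ hK₂' hK₁' hsepδ' h12' h13'
  have hχ : χd σ₁ - 1 ≠ 0 := by
    intro h0
    apply hχne
    change ιO (χd σ₁) = 1
    rw [sub_eq_zero.mp h0, map_one]
  have hδ : δd σ₁ - 1 ≠ 0 := by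
    intro h0
    apply hδne
    change ιO (δd σ₁) = 1
    rw [sub_eq_zero.mp h0, map_one]
  /- (5) triangular coordinates of `A_g^†|Γ_{K_𝔭̄}` -/
  have h10d : ∀ τ : absoluteGaloisGroup (𝔭bar.adicCompletion K),
      (((Q'⁻¹ * Δ.selfDualRep (res τ) * Q' : GL (Fin 2) (padicCoeffIntegers ιg)) :
        Matrix (Fin 2) (Fin 2) (padicCoeffIntegers ιg)) 1 0) = 0 := by
    intro τ
    have h := FrameSelfDual.conj_selfDualRep_val Δ Q' (res τ) 1 0
    have h0 : (Q'⁻¹ * Δ.ρ (res τ) * Q').val 1 0 = 0 := by rw [← hT]; exact hT10 τ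
    rw [h0, mul_zero] at h
    exact h
  obtain ⟨Φ, hΦ⟩ := exists_cofree_coordinates_triangular (F := padicCoeffField ιg) Δ.selfDualRep Q' res h10d
  obtain ⟨ρA, hρA⟩ : ∃ ρA, ρA = (Δ.selfDualCofreeRepOver K).restrict (localMap K (Sum.inl 𝔭bar)) := ⟨_, rfl⟩
  have hρA_apply : ∀ τ a, ρA τ a = (Δ.selfDualCofreeRepOver K) (localMap K (Sum.inl 𝔭bar) τ) a := fun τ a ↦ by
    rw [hρA, ContinuousRep.restrict_apply]
  have hΦ' : ∀ τ a, Φ (ρA τ a) = (χd τ • (Φ a).1 + ed τ • (Φ a).2, δd τ • (Φ a).2) := by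
    intro τ a
    have h := hΦ τ a
    refine ((congrArg Φ (?_ : ρA τ a = _)).trans h).trans ?_
    · rw [hρA]; rfl
    refine Prod.ext ?_ ?_
    · show _ = (ψv τ * (T τ).val 0 0) • (Φ a).1 + (ψv τ * (T τ).val 0 1) • (Φ a).2
      rw [hT, ← FrameSelfDual.conj_selfDualRep_val, ← FrameSelfDual.conj_selfDualRep_val]
    · show _ = (ψv τ * (T τ).val 1 1) • (Φ a).2
      rw [hT, ← FrameSelfDual.conj_selfDualRep_val]
  /- (6) `B[c]` finite, and the finiteness of the `σ₁`-fixed vectors -/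
  have hB : ∀ c : padicCoeffIntegers ιg, c ≠ 0 →
      {y : padicCoeffField ιg ⧸ LinearMap.range (Algebra.linearMap (padicCoeffIntegers ιg) (padicCoeffField ιg)) |
        c • y = 0}.Finite := fun c hc ↦ by
    have hcF : (c : padicCoeffField ιg) ≠ 0 := fun h ↦ hc (Subtype.ext h)
    haveI := finite_padicCoeffIntegers_quotient_span ιg c hcF
    exact finite_setOf_smul_quotient_eq_zero c hcF
  have key := FixTwist.finite_fixed_of_apply_sub_one_ne_zero ρA Φ χd ed δd hΦ' hB σ₁ hχ hδ
  refine key.subset fun a ha ↦ ?_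
  have h := ha.2
  rw [← hρA_apply] at h
  exact h

set_option maxHeartbeats 800000 in
-- statement-sized packages over the iterated big representation; the proof is one application
/-- **S2♭♭† granted [Wiles 1988 Thm 2.2]**: the stub `stub_localDefectFiniteAnomalous_selfDual` of line `erratum_chain`† (= binder `hLoc` of
`ErratumChainSelfDual.erratumThm23SigmaLeSelfDual_of_twoVarCore_of_localDefect`, p665011) behind the named fact
`Hida2000_thm326_ordinary_unitRoot`, by `LocalDefectAtSelfDual.stub_localDefectFiniteAnomalous_selfDual_of_finiteFixed` (p665828) and
`finiteFixedPartAnomalous_selfDual_of_thm326`. [cite: JetchevSkinnerWan2017, §3.4, Lemma 3.4.1 and proof (arXiv:1512.06894 p. 14)]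
[cite: Wiles1988, Thm. 2.2] -/
theorem stub_localDefectFiniteAnomalous_selfDual_of_thm326 (hW : Hida2000_thm326_ordinary_unitRoot) :
    ∀ {p : ℕ} [Fact p.Prime] {M : ℕ} [NeZero M] {k : ℤ}
      (g : CuspForm (CongruenceSubgroup.Gamma0 M) k) (ιg : coeffField g →+* PadicAlgCl p)
      (Δ : OrdinaryNewformDatum g p ιg)
      (K : Type) [Field K] [NumberField K] (𝔭bar : HeightOneSpectrum (𝓞 K)) (κ : ZpExtension K p)
      (γ : absoluteGaloisGroup K) [Fact (κ.IsTopGenerator γ)] (S : Finset (HeightOneSpectrum (𝓞 K))),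
      IsNewform0 g → 2 ≤ k → Even k → ¬ p ∣ M → 3 < p →
      ‖ιg ⟨(UpperHalfPlane.qExpansion 1 ⇑g).coeff p, coeff_mem_coeffField g p⟩‖ = 1 →
      IsImaginaryQuadratic K → ((Ideal.span {(p : ℤ)}).primesOver (𝓞 K)).ncard = 2 →
      ((p : ℕ) : 𝓞 K) ∈ 𝔭bar.asIdeal →
      SkinnerUrban2014.IsResiduallyIrreducible Δ →
      (∃ v : HeightOneSpectrum (𝓞 ℚ), SkinnerUrban2014.IsResiduallyRamifiedAt Δ v ∧
        ((Rat.HeightOneSpectrum.primesEquiv v : Nat.Primes) : ℕ) ∣ M ∧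
        ¬ ((Rat.HeightOneSpectrum.primesEquiv v : Nat.Primes) : ℕ) ^ 2 ∣ M ∧
        ((Ideal.span {(((Rat.HeightOneSpectrum.primesEquiv v : Nat.Primes) : ℕ) : ℤ)}).primesOver (𝓞 K)).ncard ≠ 2) →
      κ.IsAnticyclotomic → (∀ w ∈ S, ((p : ℕ) : 𝓞 K) ∉ w.asIdeal) →
      (∀ w : HeightOneSpectrum (𝓞 K), ((M : ℕ) : 𝓞 K) ∈ w.asIdeal → w ∈ S) →
      -- the corner `¬(dec)†`: a non-zero `Γ_{K_𝔭̄}`-fixed `p`-power-torsion element of the SELF-DUAL `A_g^†` (erratum L.2.1's `H⁰(K_𝔭̄, A_g[ϖ]) ≠ 0`)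
      ¬ (∀ a : Cofree Δ.selfDualRep (padicCoeffField ιg),
          (∀ σ : LocalGroup K (Sum.inl 𝔭bar), (Δ.selfDualCofreeRepOver K) (localMap K (Sum.inl 𝔭bar) σ) a = a) →
          (∃ j : ℕ, p ^ j • a = 0) → a = 0) →
      -- the complementary CYCLOTOMIC direction `κ'` with a generator `γ'`
      ∀ (κ' : ZpExtension K p) (γ' : absoluteGaloisGroup K) [Fact (κ'.IsTopGenerator γ')], κ'.IsCyclotomic →
      ∀ [TopologicalSpace (PowerSeries (padicCoeffIntegers ιg))]
        [ContinuousSMul (PowerSeries (padicCoeffIntegers ιg))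
          (BigRepModule (padicCoeffIntegers ιg) p (Cofree Δ.selfDualRep (padicCoeffField ιg)))]
        [TopologicalSpace (PowerSeries (PowerSeries (padicCoeffIntegers ιg)))]
        [ContinuousSMul (PowerSeries (PowerSeries (padicCoeffIntegers ιg)))
          (BigRepModule (PowerSeries (padicCoeffIntegers ιg)) p
            (BigRepModule (padicCoeffIntegers ιg) p (Cofree Δ.selfDualRep (padicCoeffField ιg))))],
      -- the LOCAL control defect at the strict prime is FINITE: `𝓜^{Γ_{K_𝔭̄}}/T_c 𝓜^{Γ_{K_𝔭̄}}` finite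
      Finite (QuotSMulTop (PowerSeries.X : PowerSeries (PowerSeries (padicCoeffIntegers ιg)))
        ↥((((AnticyclotomicBigGaloisRep κ' (AnticyclotomicBigGaloisRep κ (Δ.selfDualCofreeRepOver K))).restrict
          (localMap K (Sum.inl 𝔭bar))).toTopRep).ρ.invariants)) :=
  LocalDefectAtSelfDual.stub_localDefectFiniteAnomalous_selfDual_of_finiteFixed
    (finiteFixedPartAnomalous_selfDual_of_thm326 hW)

end Summit.BirchSwinnertonDyer.BirchSwinnertonDyer.Theorems.ErratumThm23TwoVariable.FixFinalSelfDual

end
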